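import Literature.NumberTheory.EllipticCurves.BhargavaShankarRegionVolume
import Mathlib.Analysis.Calculus.ContDiff.RCLike
import HarnessLib

/-!
# Geometry of the regions `Ψ(box)`: Lipschitz patches covering the frontier

Topic `Literature/NumberTheory/EllipticCurves`; continues `BhargavaShankarRegionVolume.lean`
(the boxes `paramBox T`, the parametrisation `Ψ = psi` of `G₀⁻¹ · (cone piece)`) and
`BhargavaShankarJacobianCV.lean` (`contDiffAt_psi`, local openness `image_mem_nhds_psi`).
Everything here is PROVED (no named facts).

Bhargava–Shankar control the lattice-point count of the regions `B(n,t,λ,X)` by Davenport's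
lemma (Prop. 2.6 of `arXiv:1006.1002v2`); the tree replaces Davenport's lemma by the anisotropic
Lipschitz cube count `Literature.Algebra.EuclideanLattices.abs_ncard_sub_volume_le_of_forall_patch`,
which needs the frontier of the region to be covered by finitely many coordinatewise-Lipschitz
images of `[0,1]⁴`. This file provides that input for the regions `Ψ(box)`:

* generic: a `C¹` map on an open set is Lipschitz on compact convex subsets
  (`exists_lipschitz_of_contDiffAt`, a wrapper of Mathlib's `ContDiffOn.exists_lipschitzOnWith`); if `f` is continuous on the compact
  `closure B` and locally open on `interior B` then `frontier (f '' B) ⊆ f '' (closure B ∖ interior B)`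
  (`frontier_image_subset`);
* the faces of a box `[lo, up] ⊂ ℝ⁵`, parametrised affinely by `[0,1]⁴` (`faceMap`,
  `Fin.insertNth`), cover `[lo, up] ∖ ∏(loᵢ, upᵢ)` (`Icc_diff_pi_Ioo_subset`) and are
  coordinatewise Lipschitz with constant the largest side (`faceMap_lipschitz`);
* the corners `boxLo t₁`, `boxUp t₂` of `paramBox T` for `(t₁,t₂) ⊆ T ⊆ [t₁,t₂]`, with
  `closure ⊆ [lo, up] ⊆ {y > 0}` and `∏(loᵢ,upᵢ) ⊆ interior`;
* **`exists_lipschitz_psi`** (`Ψ` is Lipschitz on `[lo, up]`) and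
  **`frontier_psi_image_subset`**: `frontier Ψ(paramBox T) ⊆ ⋃ⱼ Ψ(faceⱼ^±([0,1]⁴))` when the
  Jacobian factor `ι` of the cone does not vanish on `(t₁, t₂)`.

## References

* M. Bhargava, A. Shankar, Ann. of Math. (2) 181 (2015) 191–242, §2.3 (the regions
  `B(n,t,λ,X)` and Prop. 2.6; arXiv:1006.1002v2 numbering). [cite: BhargavaShankarAnnals2015, §2.3 and Prop. 2.6 (arXiv:1006.1002v2 numbering)]
-/

noncomputable section

open Real MeasureTheory Matrix Set Filter Topology
open scoped MatrixGroups

namespace Literature.NumberTheory.EllipticCurves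

namespace BinaryQuartic

/-! ## Generic: Lipschitz bound from `C¹` on a compact convex set -/

/-- A map which is `C¹` on an open set `U` is Lipschitz on every compact convex `K ⊆ U`
(a two-line wrapper around Mathlib's `ContDiffOn.exists_lipschitzOnWith`, in the `‖f p − f q‖ ≤ L ‖p − q‖`
form used below). [folklore] -/
theorem exists_lipschitz_of_contDiffAt {E F : Type*} [NormedAddCommGroup E] [NormedSpace ℝ E]
    [NormedAddCommGroup F] [NormedSpace ℝ F] {f : E → F} {U K : Set E}
    (hf : ∀ p ∈ U, ContDiffAt ℝ 1 f p) (hK : IsCompact K) (hKc : Convex ℝ K) (hKU : K ⊆ U) :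
    ∃ L : ℝ, 0 ≤ L ∧ ∀ p ∈ K, ∀ q ∈ K, ‖f p - f q‖ ≤ L * ‖p - q‖ := by
  have hcd : ContDiffOn ℝ 1 f K := fun p hp => (hf p (hKU hp)).contDiffWithinAt
  obtain ⟨C, hC⟩ := hcd.exists_lipschitzOnWith one_ne_zero hKc hK
  exact ⟨C, C.2, fun p hp q hq => by simpa [dist_eq_norm] using hC.dist_le_mul p hp q hq⟩

/-! ## Generic: the frontier of the image of a box -/

/-- If `f` is continuous on the compact set `closure B` and maps neighbourhoods of points of
`interior B` onto neighbourhoods, then `frontier (f '' B) ⊆ f '' (closure B ∖ interior B)`.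
[folklore] -/
theorem frontier_image_subset {E F : Type*} [TopologicalSpace E] [TopologicalSpace F] [T2Space F]
    {f : E → F} {B : Set E} (hBc : IsCompact (closure B)) (hf : ContinuousOn f (closure B))
    (hopen : ∀ p ∈ interior B, ∀ U ∈ 𝓝 p, f '' U ∈ 𝓝 (f p)) :
    frontier (f '' B) ⊆ f '' (closure B \ interior B) := by
  intro v hv
  rw [frontier, Set.mem_sdiff] at hv
  obtain ⟨hvc, hvi⟩ := hv
  have hcl : closure (f '' B) ⊆ f '' closure B := by
    refine closure_minimal (Set.image_mono subset_closure) ?_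
    exact (hBc.image_of_continuousOn hf).isClosed
  obtain ⟨p, hp, rfl⟩ := hcl hvc
  refine ⟨p, ⟨hp, fun hpi => hvi ?_⟩, rfl⟩
  rw [mem_interior_iff_mem_nhds]
  exact Filter.mem_of_superset (hopen p hpi (interior B) (isOpen_interior.mem_nhds hpi))
    (Set.image_mono interior_subset)

/-! ## Faces of a box in `ℝ⁵` parametrised by `[0,1]⁴` -/

/-- The face `{p_j = c}` of the box `[lo, up]`, parametrised affinely by `[0,1]⁴`. [folklore] -/
def faceMap (lo up : Fin 5 → ℝ) (j : Fin 5) (c : ℝ) (s : Fin 4 → ℝ) : Fin 5 → ℝ :=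
  Fin.insertNth j c fun k => lo (j.succAbove k) + s k * (up (j.succAbove k) - lo (j.succAbove k))

/-- The face map fixes coordinate `j` at `c`. [folklore] -/
theorem faceMap_apply_same (lo up : Fin 5 → ℝ) (j : Fin 5) (c : ℝ) (s : Fin 4 → ℝ) :
    faceMap lo up j c s j = c := by
  simp [faceMap]

/-- The other coordinates of the face map. [folklore] -/
theorem faceMap_apply_succAbove (lo up : Fin 5 → ℝ) (j : Fin 5) (c : ℝ) (s : Fin 4 → ℝ) (k : Fin 4) :
    faceMap lo up j c s (j.succAbove k) = lo (j.succAbove k) + s k * (up (j.succAbove k) - lo (j.succAbove k)) := by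
  simp [faceMap]

/-- The faces cover `[lo, up] ∖ ∏ (lo_i, up_i)`. [folklore] -/
theorem Icc_diff_pi_Ioo_subset (lo up : Fin 5 → ℝ) (hle : ∀ i, lo i ≤ up i) :
    Set.Icc lo up \ Set.univ.pi (fun i => Set.Ioo (lo i) (up i)) ⊆
      ⋃ j : Fin 5, (faceMap lo up j (lo j) '' Set.Icc 0 1 ∪ faceMap lo up j (up j) '' Set.Icc 0 1) := by
  intro p hp
  obtain ⟨hpI, hpn⟩ := hp
  rw [Set.mem_univ_pi] at hpn
  push Not at hpn
  obtain ⟨j, hj⟩ := hpn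
  have hpj : lo j ≤ p j ∧ p j ≤ up j := ⟨hpI.1 j, hpI.2 j⟩
  have hcases : p j = lo j ∨ p j = up j := by
    rw [Set.mem_Ioo] at hj
    push Not at hj
    by_cases h1 : lo j < p j
    · right; exact le_antisymm hpj.2 (hj h1)
    · left; exact le_antisymm (not_lt.1 h1) hpj.1
  -- the parameter `s`
  set s : Fin 4 → ℝ := fun k =>
    if up (j.succAbove k) = lo (j.succAbove k) then 0
    else (p (j.succAbove k) - lo (j.succAbove k)) / (up (j.succAbove k) - lo (j.succAbove k)) with hs
  have hs01 : s ∈ Set.Icc (0 : Fin 4 → ℝ) 1 := by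
    constructor <;> intro k <;> simp only [hs, Pi.zero_apply, Pi.one_apply]
    · split_ifs with h
      · exact le_rfl
      · have hlt : lo (j.succAbove k) < up (j.succAbove k) := lt_of_le_of_ne (hle _) (Ne.symm h)
        exact div_nonneg (by linarith [hpI.1 (j.succAbove k)]) (by linarith)
    · split_ifs with h
      · exact zero_le_one
      · have hlt : lo (j.succAbove k) < up (j.succAbove k) := lt_of_le_of_ne (hle _) (Ne.symm h)
        rw [div_le_one (by linarith)]; linarith [hpI.2 (j.succAbove k)]
  have hrec : ∀ c, p j = c → faceMap lo up j c s = p := by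
    intro c hc
    rw [faceMap, Fin.insertNth_eq_iff]
    refine ⟨hc.symm, ?_⟩
    funext k
    simp only [Fin.removeNth, hs]
    split_ifs with h
    · have h1 := hpI.1 (j.succAbove k); have h2 := hpI.2 (j.succAbove k)
      rw [h] at h2; simp; linarith
    · have hlt : lo (j.succAbove k) < up (j.succAbove k) := lt_of_le_of_ne (hle _) (Ne.symm h)
      field_simp; ring
  rw [Set.mem_iUnion]
  refine ⟨j, ?_⟩
  rcases hcases with h | h
  · exact Or.inl ⟨s, hs01, hrec _ h⟩
  · exact Or.inr ⟨s, hs01, hrec _ h⟩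

/-- The face maps are Lipschitz, coordinatewise, with constant the largest side. [folklore] -/
theorem faceMap_lipschitz (lo up : Fin 5 → ℝ) {W : ℝ} (hW : ∀ i, |up i - lo i| ≤ W) (j : Fin 5) (c : ℝ)
    (s s' : Fin 4 → ℝ) (i : Fin 5) : |faceMap lo up j c s i - faceMap lo up j c s' i| ≤ W * dist s s' := by
  have hW0 : 0 ≤ W := (abs_nonneg _).trans (hW 0)
  rcases Fin.eq_self_or_eq_succAbove j i with rfl | ⟨k, rfl⟩
  · rw [faceMap_apply_same, faceMap_apply_same, sub_self, abs_zero]; positivity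
  · rw [faceMap_apply_succAbove, faceMap_apply_succAbove]
    have e : lo (j.succAbove k) + s k * (up (j.succAbove k) - lo (j.succAbove k)) -
        (lo (j.succAbove k) + s' k * (up (j.succAbove k) - lo (j.succAbove k))) =
        (s k - s' k) * (up (j.succAbove k) - lo (j.succAbove k)) := by ring
    rw [e, abs_mul]
    calc |s k - s' k| * |up (j.succAbove k) - lo (j.succAbove k)| ≤ dist s s' * W :=
          mul_le_mul (by rw [← Real.dist_eq]; exact dist_le_pi_dist s s' k) (hW _) (abs_nonneg _) dist_nonneg
      _ = W * dist s s' := mul_comm _ _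

/-! ## The boxes `paramBox T`: closure, interior, bounds -/

/-- Lower corner of the parameter box with `τ ∈ [t₁, t₂]`. [folklore] -/
def boxLo (t₁ : ℝ) : Fin 5 → ℝ := ![-δ₀, 1 - δ₀, -δ₀, 0, t₁]

/-- Upper corner. [folklore] -/
def boxUp (t₂ : ℝ) : Fin 5 → ℝ := ![δ₀, 1 + δ₀, δ₀, 1, t₂]

/-- `lo ≤ up`. [folklore] -/
theorem boxLo_le_boxUp {t₁ t₂ : ℝ} (ht : t₁ ≤ t₂) (i : Fin 5) : boxLo t₁ i ≤ boxUp t₂ i := by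
  fin_cases i <;> simp [boxLo, boxUp] <;> norm_num [δ₀]
  exact ht

/-- The sides of the box are `≤ 4` when `t₂ − t₁ ≤ 4`. [folklore] -/
theorem abs_boxUp_sub_boxLo_le {t₁ t₂ : ℝ} (ht : t₁ ≤ t₂) (ht4 : t₂ - t₁ ≤ 4) (i : Fin 5) :
    |boxUp t₂ i - boxLo t₁ i| ≤ 4 := by
  rw [abs_of_nonneg (by linarith [boxLo_le_boxUp ht i])]
  fin_cases i <;> simp [boxLo, boxUp] <;> norm_num [δ₀]
  linarith

/-- `paramBox T ⊆ [lo, up]` for `T ⊆ [t₁, t₂]`. [folklore] -/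
theorem paramBox_subset_Icc {T : Set ℝ} {t₁ t₂ : ℝ} (hT : T ⊆ Set.Icc t₁ t₂) :
    paramBox T ⊆ Set.Icc (boxLo t₁) (boxUp t₂) := by
  intro p hp
  obtain ⟨h0, h1, h2, h3, h4⟩ := mem_paramBox_iff.1 hp
  have h4' := hT h4
  constructor <;> intro i <;> fin_cases i <;>
    simp [boxLo, boxUp, h0.1.le, h0.2.le, h1.1.le, h1.2.le, h2.1, h2.2.le, h3.1.le, h3.2.le, h4'.1, h4'.2]

/-- The closure of the box lies in `[lo, up]`. [folklore] -/
theorem closure_paramBox_subset {T : Set ℝ} {t₁ t₂ : ℝ} (hT : T ⊆ Set.Icc t₁ t₂) :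
    closure (paramBox T) ⊆ Set.Icc (boxLo t₁) (boxUp t₂) :=
  closure_minimal (paramBox_subset_Icc hT) isClosed_Icc

/-- The open box lies in the interior of `paramBox T` when `(t₁, t₂) ⊆ T`. [folklore] -/
theorem pi_Ioo_subset_interior_paramBox {T : Set ℝ} {t₁ t₂ : ℝ} (hT : Set.Ioo t₁ t₂ ⊆ T) :
    Set.univ.pi (fun i => Set.Ioo (boxLo t₁ i) (boxUp t₂ i)) ⊆ interior (paramBox T) := by
  have hopen : IsOpen (Set.univ.pi fun i => Set.Ioo (boxLo t₁ i) (boxUp t₂ i)) :=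
    isOpen_set_pi Set.finite_univ fun i _ => isOpen_Ioo
  refine interior_maximal ?_ hopen
  intro p hp
  rw [Set.mem_univ_pi] at hp
  have h0 := hp 0; have h1 := hp 1; have h2 := hp 2; have h3 := hp 3; have h4 := hp 4
  simp only [boxLo, boxUp, Matrix.cons_val_zero, Matrix.cons_val_one, Matrix.cons_val, Fin.isValue] at h0 h1 h2 h3 h4
  exact mem_paramBox_iff.2 ⟨h0, h1, ⟨h2.1.le, h2.2⟩, h3, hT h4⟩

/-- `[lo, up] ⊆ {y > 0}`. [folklore] -/
theorem Icc_box_subset_pos (t₁ t₂ : ℝ) : Set.Icc (boxLo t₁) (boxUp t₂) ⊆ {p : Fin 5 → ℝ | 0 < p 1} := by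
  intro p hp
  have := hp.1 1
  simp only [boxLo, Matrix.cons_val_one, Matrix.cons_val_zero, Fin.isValue] at this
  simp only [Set.mem_setOf_eq]; norm_num [δ₀] at this; linarith

/-! ## Lipschitz patches and frontier for the cone pieces -/

/-- **`Ψ` is Lipschitz on the closed box**: there is `L ≥ 0` with
`‖Ψ(p) − Ψ(q)‖ ≤ L ‖p − q‖` on `[lo, up]` (it is `C¹` on the open set `{y > 0} ⊇ [lo, up]`).
[folklore] -/
theorem exists_lipschitz_psi (C : SmoothCurve) (t₁ t₂ : ℝ) :
    ∃ L : ℝ, 0 ≤ L ∧ ∀ p ∈ Set.Icc (boxLo t₁) (boxUp t₂), ∀ q ∈ Set.Icc (boxLo t₁) (boxUp t₂),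
      ‖psi C.cone p - psi C.cone q‖ ≤ L * ‖p - q‖ := by
  exact exists_lipschitz_of_contDiffAt (fun p hp => contDiffAt_psi p hp) (isCompact_Icc)
    (convex_Icc _ _) (Icc_box_subset_pos t₁ t₂)

/-- **The frontier of `Ψ(box)` is covered by the images of the faces**, for a cone over a curve
whose Jacobian factor `ι` does not vanish on `(t₁, t₂)` and a parameter set
`(t₁, t₂) ⊆ T ⊆ [t₁, t₂]`. [folklore] -/
theorem frontier_psi_image_subset (C : SmoothCurve) {T : Set ℝ} {t₁ t₂ : ℝ} (ht : t₁ ≤ t₂)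
    (hT₁ : Set.Ioo t₁ t₂ ⊆ T) (hT₂ : T ⊆ Set.Icc t₁ t₂) (hι : ∀ τ ∈ Set.Ioo t₁ t₂, C.iota τ ≠ 0) :
    frontier (psi C.cone '' paramBox T) ⊆
      ⋃ j : Fin 5, (psi C.cone ∘ faceMap (boxLo t₁) (boxUp t₂) j (boxLo t₁ j) '' Set.Icc 0 1 ∪
        psi C.cone ∘ faceMap (boxLo t₁) (boxUp t₂) j (boxUp t₂ j) '' Set.Icc 0 1) := by
  have hcl := closure_paramBox_subset hT₂
  have hcpt : IsCompact (closure (paramBox T)) := (isCompact_Icc).of_isClosed_subset isClosed_closure hcl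
  have hcont : ContinuousOn (psi C.cone) (closure (paramBox T)) := by
    intro p hp
    exact (contDiffAt_psi p (Icc_box_subset_pos t₁ t₂ (hcl hp))).continuousAt.continuousWithinAt
  have hopen : ∀ p ∈ interior (paramBox T), ∀ U ∈ 𝓝 p, psi C.cone '' U ∈ 𝓝 (psi C.cone p) := by
    intro p hp U hU
    have hpB : p ∈ paramBox T := interior_subset hp
    obtain ⟨-, h1, -, h3, h4⟩ := mem_paramBox_iff.1 hpB
    have hy : 0 < p 1 := paramBox_subset T hpB
    -- `τ = p 4` lies in the open interval: the interior of the box has `p 4 ∈ interior T ⊆ (t₁,t₂)`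
    have hτ : p 4 ∈ Set.Ioo t₁ t₂ := by
      have hint : interior (paramBox T) ⊆ Set.univ.pi fun i => interior (boxSides T i) := by
        rw [paramBox, ← interior_pi_set Set.finite_univ]
      have := Set.mem_univ_pi.1 (hint hp) 4
      simp only [boxSides_four] at this
      have hsub : interior T ⊆ Set.Ioo t₁ t₂ := by
        calc interior T ⊆ interior (Set.Icc t₁ t₂) := interior_mono hT₂
          _ = Set.Ioo t₁ t₂ := interior_Icc
      exact hsub this
    refine image_mem_nhds_psi hy ?_ hU
    rw [C.jacIJ_cone]
    exact mul_ne_zero (pow_ne_zero 4 h3.1.ne') (hι _ hτ)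
  intro v hv
  obtain ⟨p, ⟨hpc, hpi⟩, rfl⟩ := frontier_image_subset hcpt hcont hopen hv
  have hp' : p ∈ Set.Icc (boxLo t₁) (boxUp t₂) \ Set.univ.pi (fun i => Set.Ioo (boxLo t₁ i) (boxUp t₂ i)) :=
    ⟨hcl hpc, fun h => hpi (pi_Ioo_subset_interior_paramBox hT₁ h)⟩
  obtain ⟨j, hj⟩ := Set.mem_iUnion.1 (Icc_diff_pi_Ioo_subset _ _ (boxLo_le_boxUp ht) hp')
  rw [Set.mem_iUnion]
  refine ⟨j, ?_⟩
  rcases hj with ⟨s, hs, rfl⟩ | ⟨s, hs, rfl⟩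
  · exact Or.inl ⟨s, hs, rfl⟩
  · exact Or.inr ⟨s, hs, rfl⟩

end BinaryQuartic

end Literature.NumberTheory.EllipticCurves

end
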